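import Mathlib
import Literature.Probability.Percolation.DiagonalStripHyperplanePoint
import HarnessLib

/-!
# IP12 eq. (25) up to a scalar: `Ψ_L|_{z_{i+1} = q z_i} ∝ φ_i Ψ_{L-2}(ẑ)`

Topic `Literature/Probability/Percolation`. Ikhlef–Ponsaing (J. Stat. Phys. 149 (2012),
arXiv:1202.5476) §3.4, eq. (25): on the hyperplane `H_i = {z_{i+1} = q z_i}` the ground state of
`t_L(w; z)` is `φ_i Ψ_{L-2}(ẑ)` times a scalar. This file proves the statement UP TO THE SCALAR
(the scalar `(-1)^L ∏ k(z_i, z_j)` of (25) depends on the normalisation of `Ψ` and is the business of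
the qKZ pinning), in the generic setting of `DiagonalStripGenericRapidities.lean` /
`DiagonalStripGenericSimplicity.lean` over `ℂ`:

* `mapMatrix_hom_ipNMat`, `adjugate_sub_one_ne_zero_of_specialisation` — clearing denominators
  and rank semicontinuity of `t - 1` through adjugates under an ARBITRARY substitution `g` of the
  rapidities and a closed point factoring through it (generalising the percolation-point argument);
* `hypSubst q i` (`z_{i+1} ↦ q z_i`), `hatRename i` (`ẑ`: `z_k ↦ z_{k+2}` for `k ≥ i`), `genZH` (the
  generic rapidities of `H_i`), `zHat_genZH`;
* **LEMMA A** `adjugate_ipTMatH_sub_one_ne_zero_even/odd`, `ipTransferMatrixW_hyp_fixed_proportional`: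
  over the function field of `H_i` (`1 ≤ i ≤ L - 1`) any two `t|_{H_i}`-fixed vectors are proportional
  (from the closed point `P_i` of `DiagonalStripHyperplanePoint.lean`);
* `fixed_of_hom` — a polynomial `t`-fixed vector stays fixed after an admissible substitution; hence
  `toRF_hypSubst_fixed` (the restriction `Ψ_L|_{H_i}` is `t|_{H_i}`-fixed) and `toRF_hatRename_fixed`
  (`Ψ_{L-2}(ẑ)` is `t_{L-2}(ẑ)`-fixed);
* `fixed_pushforward_cpInsIso/cpInsDup` — by Lemma 3.3 (`DiagonalStripTransferRecursion.lean`) at the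
  generic point of `H_i`, the push-forward `φ_i Ψ_{L-2}(ẑ)` is `t|_{H_i}`-fixed;
* **`groundState_hyp_recursion_even/odd`** — the two are proportional; `pushforward_…_ne_zero` — the
  push-forward is nonzero, so the scalar is a genuine element of the function field of `H_i`.

## References

* Y. Ikhlef, A. K. Ponsaing, *Finite-size left-passage probability in percolation*, J. Stat. Phys.
  149 (2012) 10–36, arXiv:1202.5476, §3.4, eq. (25). [IkhlefPonsaing2012]
-/

namespace Literature.Probability.Percolation

open Finset Literature.Probability.LatticeModels Literature.Probability.LatticeModels.TemperleyLieb

/-! ### Clearing denominators under an arbitrary ring homomorphism -/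

section GeneralHom

open MvPolynomial _root_.Matrix

variable {K₀ K : Type*} [Field K₀] [Field K] {m : ℕ}

/-- **The weights as ratios of polynomials, under any specialisation** `f` of the rapidities at which
the denominators and the rapidities are nonzero: `weight · f(den) = f(num)`.
[cite: IkhlefPonsaing2012, Def. 3.1, 3.3] -/
theorem ipRowWeight_hom_mul_den (f : MvPolynomial ℕ K₀ →+* K) {q : K₀} (hq : f (C q) ≠ 0)
    (hw : f (X 0) ≠ 0) (r : Fin 2) {e : Sym2 (Site 2)} (hz : f (X (edgeTopLevel e).toNat) ≠ 0)
    (hden : f (ipDenPoly q r e) ≠ 0) :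
    ipRowWeight (f (C q)) (f (X 0)) (fun k => f (X k)) r e * f (ipDenPoly q r e) = f (ipNumPoly q r e) := by
  set q' := f (C q) with hq'
  set w' := f (X 0) with hw'
  set z' := f (X (edgeTopLevel e).toNat) with hz'
  -- the two bracket denominators
  have hden0 : f (ipDenPoly q 0 e) = q' ^ 2 * w' ^ 2 - z' ^ 2 := by
    simp [ipDenPoly, hq', hw', hz', map_sub, map_mul, map_pow]
  have hden1 : f (ipDenPoly q 1 e) = q' ^ 2 * w' ^ 2 * z' ^ 2 - 1 := by
    simp [ipDenPoly, hq', hw', hz', map_sub, map_mul, map_pow, show (1 : Fin 2) ≠ 0 from by decide]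
  have hb0 : r = 0 → qbr (q' / (z' / w')) ≠ 0 := by
    rintro rfl h
    apply hden
    rw [hden0]
    have key : qbr (q' / (z' / w')) * (q' * w' * z') = q' ^ 2 * w' ^ 2 - z' ^ 2 := by
      unfold qbr; field_simp
    rw [← key, h, zero_mul]
  have hb1 : r = 1 → qbr (q' / (w' * z')⁻¹) ≠ 0 := by
    rintro rfl h
    apply hden
    rw [hden1]
    have key : qbr (q' / (w' * z')⁻¹) * (q' * w' * z') = q' ^ 2 * w' ^ 2 * z' ^ 2 - 1 := by
      unfold qbr; rw [div_inv_eq_mul]; field_simp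
    rw [← key, h, zero_mul]
  unfold ipRowWeight ipNumPoly ipDenPoly ipWtA ipWtB
  obtain rfl | hr := eq_or_ne r 0
  · have hb := hb0 rfl
    simp only [if_true]
    split_ifs <;> simp only [map_sub, map_mul, map_pow, ← hq', ← hw', ← hz'] <;>
      rw [div_mul_eq_mul_div, div_eq_iff hb] <;> unfold qbr <;> field_simp
  · obtain rfl := Fin.eq_one_of_ne_zero r hr
    have hb := hb1 rfl
    simp only [show (1 : Fin 2) ≠ 0 from by decide, if_false]
    split_ifs <;> simp only [map_sub, map_mul, map_pow, map_one, ← hq', ← hw', ← hz'] <;>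
      rw [div_mul_eq_mul_div, div_eq_iff hb] <;> unfold qbr <;> field_simp

/-- **Clearing denominators under any specialisation**: `f(N) = f(Δ) · (t_f - 1)` where `t_f` is the
transfer matrix with the specialised rapidities `q ↦ f(C q)`, `w ↦ f(X 0)`, `z_k ↦ f(X k)`.
[folklore] -/
theorem mapMatrix_hom_ipNMat (f : MvPolynomial ℕ K₀ →+* K) {q : K₀} (hq : f (C q) ≠ 0) (hw : f (X 0) ≠ 0)
    (hz : ∀ k, k ≠ 0 → f (X k) ≠ 0)
    (hden0 : ∀ e ∈ latticeLayer m 0, f (ipDenPoly q 0 e) ≠ 0)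
    (hden1 : ∀ e ∈ latticeLayer m 1, f (ipDenPoly q 1 e) ≠ 0) :
    f.mapMatrix (ipNMat m q) = f (ipDeltaPoly m q) •
      (Matrix.of (fun Q Q' => ipTransferMatrixW m (f (C q)) (f (X 0)) (fun k => f (X k)) Q Q') - 1) := by
  refine Matrix.ext fun Q Q' => ?_
  rw [RingHom.mapMatrix_apply, Matrix.map_apply]
  simp only [ipNMat, Matrix.sub_apply, Matrix.smul_apply, Matrix.of_apply, Matrix.one_apply,
    smul_eq_mul, map_sub, map_mul, mul_sub]
  congr 1
  · rw [map_ipTwoLayerWR]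
    set p₀ : Sym2 (Site 2) → K := ipRowWeight (f (C q)) (f (X 0)) (fun k => f (X k)) 0
    set p₁ : Sym2 (Site 2) → K := ipRowWeight (f (C q)) (f (X 0)) (fun k => f (X k)) 1
    have h0 : ∀ e ∈ latticeLayer m 0,
        (f ∘ ipNumPoly q 0) e = f (ipDenPoly q 0 e) * p₀ e ∧
        (f ∘ fun e => ipDenPoly q 0 e - ipNumPoly q 0 e) e = f (ipDenPoly q 0 e) * (1 - p₀ e) := by
      intro e he
      have hk := level_ne_zero_of_mem (Or.inl rfl) he
      have h := ipRowWeight_hom_mul_den f hq hw 0 (hz _ hk) (hden0 e he)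
      refine ⟨by rw [Function.comp_apply, mul_comm, h], ?_⟩
      rw [Function.comp_apply, map_sub, mul_sub, mul_one, mul_comm, h]
    have h1 : ∀ e ∈ latticeLayer m 1,
        (f ∘ ipNumPoly q 1) e = f (ipDenPoly q 1 e) * p₁ e ∧
        (f ∘ fun e => ipDenPoly q 1 e - ipNumPoly q 1 e) e = f (ipDenPoly q 1 e) * (1 - p₁ e) := by
      intro e he
      have hk := level_ne_zero_of_mem (Or.inr rfl) he
      have h := ipRowWeight_hom_mul_den f hq hw 1 (hz _ hk) (hden1 e he)
      refine ⟨by rw [Function.comp_apply, mul_comm, h], ?_⟩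
      rw [Function.comp_apply, map_sub, mul_sub, mul_one, mul_comm, h]
    rw [ipTwoLayerWR_congr h0 h1, ipTwoLayerWR_mul, ← ipTwoLayerW_eq_ipTwoLayerWR, ← ipTransferMatrixW_eq,
      ipDeltaPoly, map_mul, map_prod, map_prod]
  · split_ifs <;> simp

/-- `f(Δ) ≠ 0` when the denominators do not vanish. [folklore] -/
theorem hom_ipDeltaPoly_ne_zero (f : MvPolynomial ℕ K₀ →+* K) {q : K₀}
    (hden0 : ∀ e ∈ latticeLayer m 0, f (ipDenPoly q 0 e) ≠ 0)
    (hden1 : ∀ e ∈ latticeLayer m 1, f (ipDenPoly q 1 e) ≠ 0) : f (ipDeltaPoly m q) ≠ 0 := by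
  rw [ipDeltaPoly, map_mul, map_prod, map_prod]
  exact mul_ne_zero (Finset.prod_ne_zero_iff.2 hden0) (Finset.prod_ne_zero_iff.2 hden1)

/-- Composition of `mapMatrix`. [folklore] -/
theorem mapMatrix_mapMatrix {A B C : Type*} [Semiring A] [Semiring B] [Semiring C] {ι : Type*} [Fintype ι]
    [DecidableEq ι] (f : A →+* B) (g : B →+* C) (M : Matrix ι ι A) :
    g.mapMatrix (f.mapMatrix M) = (g.comp f).mapMatrix M := by
  ext i j; rfl

/-- **Rank semicontinuity through adjugates, general form.** Let `g` be an endomorphism of the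
polynomial ring (a substitution of the rapidities) and `f₀` a specialisation into a field that
factors through `g` (`f₀ ∘ g = f₀`). If the adjugate of `t_{f₀} - 1` is nonzero, so is the adjugate
of `t_{toRF ∘ g} - 1` over the rapidity field. [folklore] -/
theorem adjugate_sub_one_ne_zero_of_specialisation (g : MvPolynomial ℕ K₀ →+* MvPolynomial ℕ K₀)
    (f₀ : MvPolynomial ℕ K₀ →+* K) (hfg : f₀.comp g = f₀) {q : K₀}
    (hq : (toRF K₀).comp g (C q) ≠ 0) (hw : (toRF K₀).comp g (X 0) ≠ 0)
    (hz : ∀ k, k ≠ 0 → (toRF K₀).comp g (X k) ≠ 0)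
    (hden0 : ∀ e ∈ latticeLayer m 0, (toRF K₀).comp g (ipDenPoly q 0 e) ≠ 0)
    (hden1 : ∀ e ∈ latticeLayer m 1, (toRF K₀).comp g (ipDenPoly q 1 e) ≠ 0)
    (hq₀ : f₀ (C q) ≠ 0) (hw₀ : f₀ (X 0) ≠ 0) (hz₀ : ∀ k, k ≠ 0 → f₀ (X k) ≠ 0)
    (hden0₀ : ∀ e ∈ latticeLayer m 0, f₀ (ipDenPoly q 0 e) ≠ 0)
    (hden1₀ : ∀ e ∈ latticeLayer m 1, f₀ (ipDenPoly q 1 e) ≠ 0)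
    (h0 : adjugate (Matrix.of (fun Q Q' => ipTransferMatrixW m (f₀ (C q)) (f₀ (X 0)) (fun k => f₀ (X k)) Q Q') - 1) ≠ 0) :
    adjugate (Matrix.of (fun Q Q' => ipTransferMatrixW m ((toRF K₀).comp g (C q)) ((toRF K₀).comp g (X 0))
      (fun k => (toRF K₀).comp g (X k)) Q Q') - 1) ≠ 0 := by
  intro h
  set N := g.mapMatrix (ipNMat m q) with hN
  -- the adjugate of the substituted polynomial matrix vanishes
  have hNadj : adjugate N = 0 := by
    have h1 : (toRF K₀).mapMatrix (adjugate N) = 0 := by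
      rw [RingHom.map_adjugate, hN, mapMatrix_mapMatrix, mapMatrix_hom_ipNMat _ hq hw hz hden0 hden1,
        adjugate_smul, h, smul_zero]
    refine Matrix.ext fun Q Q' => ?_
    have := congrArg (fun M : Matrix _ _ (RapidityField K₀) => M Q Q') h1
    simp only [RingHom.mapMatrix_apply, Matrix.map_apply, Matrix.zero_apply] at this
    rw [Matrix.zero_apply]
    exact toRF_injective (by rw [this, map_zero])
  -- hence so does its specialisation
  have h3 : adjugate (f₀ (ipDeltaPoly m q) •
      (Matrix.of (fun Q Q' => ipTransferMatrixW m (f₀ (C q)) (f₀ (X 0)) (fun k => f₀ (X k)) Q Q') - 1)) = 0 := by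
    have hf : f₀.mapMatrix (ipNMat m q) = f₀.mapMatrix N := by
      rw [hN, mapMatrix_mapMatrix, hfg]
    rw [← mapMatrix_hom_ipNMat f₀ hq₀ hw₀ hz₀ hden0₀ hden1₀, hf, ← RingHom.map_adjugate, hNadj, map_zero]
  rw [adjugate_smul, smul_eq_zero] at h3
  rcases h3 with h3 | h3
  · exact pow_ne_zero _ (hom_ipDeltaPoly_ne_zero f₀ hden0₀ hden1₀) h3
  · exact h0 h3

end GeneralHom

/-! ### The hyperplane `z_{i+1} = q z_i` in the generic setting -/

section Hyperplane

open MvPolynomial _root_.Matrix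

variable {K₀ : Type*} [Field K₀]

/-- **The substitution `z_{i+1} ↦ q z_i`** (restriction to the hyperplane `H_i`). [folklore] -/
noncomputable def hypSubst (q : K₀) (i : ℕ) : MvPolynomial ℕ K₀ →+* MvPolynomial ℕ K₀ :=
  (MvPolynomial.aeval (R := K₀) fun k => if k = i + 1 then C q * X i else (X k : MvPolynomial ℕ K₀)).toRingHom

/-- `hypSubst` on variables. [folklore] -/
theorem hypSubst_X (q : K₀) (i k : ℕ) :
    hypSubst q i (X k) = if k = i + 1 then C q * X i else X k := by
  simp [hypSubst]

/-- `hypSubst` on constants. [folklore] -/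
theorem hypSubst_C (q : K₀) (i : ℕ) (c : K₀) : hypSubst q i (C c) = C c := by
  simp [hypSubst]

/-- **A specialisation on the hyperplane factors through the substitution.** [folklore] -/
theorem eval_comp_hypSubst {q : K₀} {i : ℕ} {x : ℕ → K₀} (hx : x (i + 1) = q * x i) :
    (eval x).comp (hypSubst q i) = eval x := by
  refine MvPolynomial.ringHom_ext (fun c => ?_) (fun k => ?_)
  · rw [RingHom.comp_apply, hypSubst_C, eval_C]
  · rw [RingHom.comp_apply, hypSubst_X]
    split_ifs with h
    · rw [map_mul, eval_C, eval_X, eval_X, h, hx]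
    · rw [eval_X]

/-- **The renaming `z_k ↦ z_k` (`k < i`), `z_k ↦ z_{k+2}` (`k ≥ i`)** (IP12's `ẑ` on polynomials).
[cite: IkhlefPonsaing2012, Lemma 3.3] -/
noncomputable def hatRename (i : ℕ) : MvPolynomial ℕ K₀ →+* MvPolynomial ℕ K₀ :=
  (MvPolynomial.rename (R := K₀) fun k => if k < i then k else k + 2).toRingHom

/-- `hatRename` on variables. [folklore] -/
theorem hatRename_X (i k : ℕ) : hatRename (K₀ := K₀) i (X k) = X (if k < i then k else k + 2) := by
  simp [hatRename]

/-- `hatRename` on constants. [folklore] -/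
theorem hatRename_C (i : ℕ) (c : K₀) : hatRename i (C c) = C c := by
  simp [hatRename]

/-- `hatRename` is injective. [folklore] -/
theorem hatRename_injective (i : ℕ) : Function.Injective (hatRename (K₀ := K₀) i) := by
  refine MvPolynomial.rename_injective _ fun a b h => ?_
  split_ifs at h <;> omega

variable (K₀) in
/-- **The generic rapidities on the hyperplane**: `z_k = X_k` except `z_{i+1} = q X_i`. [folklore] -/
noncomputable def genZH (q : K₀) (i : ℕ) : ℕ → RapidityField K₀ := fun k => (toRF K₀).comp (hypSubst q i) (X k)

/-- Values of `genZH`. [folklore] -/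
theorem genZH_apply (q : K₀) (i k : ℕ) :
    genZH K₀ q i k = if k = i + 1 then genC K₀ q * genZ K₀ i else genZ K₀ k := by
  unfold genZH
  rw [RingHom.comp_apply, hypSubst_X]
  split_ifs <;> simp [genC, genZ, map_mul]

/-- `genZH` lies on the hyperplane. [folklore] -/
theorem genZH_hyp (q : K₀) (i : ℕ) : genZH K₀ q i (i + 1) = genC K₀ q * genZH K₀ q i i := by
  rw [genZH_apply, genZH_apply, if_pos rfl, if_neg (by omega)]

/-- `ẑ` of `genZH` is the renamed generic sequence. [folklore] -/
theorem zHat_genZH (q : K₀) (i : ℕ) :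
    zHat (genZH K₀ q i) i = fun k => (toRF K₀).comp (hatRename i) (X k) := by
  funext k
  rw [zHat_apply, genZH_apply, genZH_apply, RingHom.comp_apply, hatRename_X]
  by_cases hk : k < i
  · rw [if_pos hk, if_neg (by omega), if_pos hk]; rfl
  · rw [if_neg hk, if_neg (by omega), if_neg hk]; rfl

/-- The substitution fixes `q` and `w`, in the rapidity field. [folklore] -/
theorem comp_hypSubst_C_X0 (q : K₀) (i : ℕ) :
    (toRF K₀).comp (hypSubst q i) (C q) = genC K₀ q ∧ (toRF K₀).comp (hypSubst q i) (X 0) = genW K₀ := by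
  refine ⟨by rw [RingHom.comp_apply, hypSubst_C]; rfl, ?_⟩
  rw [RingHom.comp_apply, hypSubst_X, if_neg (by omega)]; rfl

/-- The renaming fixes `q` and `w` (for `i ≠ 0`), in the rapidity field. [folklore] -/
theorem comp_hatRename_C_X0 (q : K₀) {i : ℕ} (hi : i ≠ 0) :
    (toRF K₀).comp (hatRename i) (C q) = genC K₀ q ∧ (toRF K₀).comp (hatRename i) (X 0) = genW K₀ := by
  refine ⟨by rw [RingHom.comp_apply, hatRename_C]; rfl, ?_⟩
  rw [RingHom.comp_apply, hatRename_X, if_pos (Nat.pos_of_ne_zero hi)]; rfl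

/-- Non-degeneracy of the substitution: rapidities and denominators stay nonzero. [folklore] -/
theorem hypSubst_nondeg {q : K₀} (hq : q ≠ 0) {i : ℕ} (hi : i ≠ 0) (m : ℕ) :
    (∀ k, k ≠ 0 → (toRF K₀).comp (hypSubst q i) (X k) ≠ 0) ∧
    (∀ e ∈ latticeLayer m 0, (toRF K₀).comp (hypSubst q i) (ipDenPoly q 0 e) ≠ 0) ∧
    (∀ e ∈ latticeLayer m 1, (toRF K₀).comp (hypSubst q i) (ipDenPoly q 1 e) ≠ 0) := by
  -- the test point `X 0 ↦ 1`, all other variables `↦ 0` lies on the hyperplane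
  set x : ℕ → K₀ := fun k => if k = 0 then 1 else 0 with hx
  have hxh : x (i + 1) = q * x i := by simp [hx, hi]
  have hev : ∀ P, eval x (hypSubst q i P) = eval x P := fun P => by
    rw [← RingHom.comp_apply, eval_comp_hypSubst hxh]
  have hx0 : x 0 = 1 := by simp [hx]
  refine ⟨fun k hk h => ?_, fun e he => ?_, fun e he => ?_⟩
  · rw [RingHom.comp_apply, hypSubst_X] at h
    split_ifs at h
    · have : toRF K₀ (C q * X i) ≠ 0 := by
        rw [map_mul]; exact mul_ne_zero (toRF_ne_zero_of_eval (fun _ => 1) (by simp [hq])) (genZ_ne_zero i)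
      exact this h
    · exact genZ_ne_zero k h
  · rw [RingHom.comp_apply]
    refine toRF_ne_zero_of_eval x ?_
    have hk := level_ne_zero_of_mem (Or.inl rfl) he
    have hxk : x (edgeTopLevel e).toNat = 0 := by simp [hx, hk]
    rw [hev]
    simp only [ipDenPoly, if_true, map_sub, map_mul, map_pow, eval_C, eval_X, hxk, hx0]
    simpa using pow_ne_zero 2 hq
  · rw [RingHom.comp_apply]
    refine toRF_ne_zero_of_eval x ?_
    have hk := level_ne_zero_of_mem (Or.inr rfl) he
    have hxk : x (edgeTopLevel e).toNat = 0 := by simp [hx, hk]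
    rw [hev]
    simp only [ipDenPoly, show (1 : Fin 2) ≠ 0 from by decide, if_false, map_sub, map_mul, map_pow, map_one,
      eval_C, eval_X, hxk, hx0]
    norm_num

/-- Non-degeneracy of the renaming. [folklore] -/
theorem hatRename_nondeg {q : K₀} (hq : q ≠ 0) (i : ℕ) (m : ℕ) :
    (∀ k, k ≠ 0 → (toRF K₀).comp (hatRename i) (X k) ≠ 0) ∧
    (∀ e ∈ latticeLayer m 0, (toRF K₀).comp (hatRename i) (ipDenPoly q 0 e) ≠ 0) ∧
    (∀ e ∈ latticeLayer m 1, (toRF K₀).comp (hatRename i) (ipDenPoly q 1 e) ≠ 0) := by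
  have hne : ∀ P : MvPolynomial ℕ K₀, P ≠ 0 → (toRF K₀).comp (hatRename i) P ≠ 0 := by
    intro P hP h
    rw [RingHom.comp_apply] at h
    exact hP (hatRename_injective i (by rw [toRF_injective (h.trans (map_zero _).symm), map_zero]))
  refine ⟨fun k _ => hne _ (X_ne_zero _), fun e he => hne _ fun h => ?_, fun e he => hne _ fun h => ?_⟩
  · exact toRF_ipDenPoly_ne_zero hq 0 (level_ne_zero_of_mem (Or.inl rfl) he) (by rw [h, map_zero])
  · exact toRF_ipDenPoly_ne_zero hq 1 (level_ne_zero_of_mem (Or.inr rfl) he) (by rw [h, map_zero])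

end Hyperplane

/-! ### LEMMA A: the adjugate of `t|_{H_i} - 1` is nonzero -/

section LemmaA

open MvPolynomial _root_.Matrix Literature.LinearAlgebra.Matrix

variable {n : ℕ}

/-- **The generic transfer matrix restricted to the hyperplane `H_i = {z_{i+1} = q z_i}`.**
[cite: IkhlefPonsaing2012, §3.4] -/
noncomputable def ipTMatH (n : ℕ) (q : ℂ) (i : ℕ) : Matrix (ColPattern (n + 1)) (ColPattern (n + 1)) (RapidityField ℂ) :=
  Matrix.of fun Q Q' => ipTransferMatrixW (n + 1) (genC ℂ q) (genW ℂ) (genZH ℂ q i) Q Q'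

/-- Non-degeneracy of the specialisation at `P_i`. [folklore] -/
theorem hypPt_eval_nondeg {q w₀ ζ₀ : ℂ} (hq : q ^ 2 + q + 1 = 0) (hw : w₀ ^ 2 = -q) (hζ : ζ₀ ^ 2 = -q ^ 2)
    {i : ℕ} (hi : i ≠ 0) (m : ℕ) :
    eval (ipHypPt q w₀ ζ₀ i) (C q) ≠ 0 ∧ eval (ipHypPt q w₀ ζ₀ i) (X 0) ≠ 0 ∧
    (∀ k, k ≠ 0 → eval (ipHypPt q w₀ ζ₀ i) (X k) ≠ 0) ∧
    (∀ e ∈ latticeLayer m 0, eval (ipHypPt q w₀ ζ₀ i) (ipDenPoly q 0 e) ≠ 0) ∧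
    (∀ e ∈ latticeLayer m 1, eval (ipHypPt q w₀ ζ₀ i) (ipDenPoly q 1 e) ≠ 0) := by
  have hq0 : q ≠ 0 := q_ne_zero_of_quad hq
  have hq1 : q ≠ 1 := by rintro rfl; norm_num at hq
  have hq3 : q ^ 3 = 1 := by linear_combination (q - 1) * hq
  have hw0 : w₀ ≠ 0 := by rintro rfl; apply hq0; linear_combination hw
  have h0 : ipHypPt q w₀ ζ₀ i 0 = w₀ := by simp [ipHypPt, hi.symm]
  -- the squares of the rapidities at positive levels are `1`, `-q²` or `-q`
  have hsq : ∀ k, k ≠ 0 → (ipHypPt q w₀ ζ₀ i k) ^ 2 = 1 ∨ (ipHypPt q w₀ ζ₀ i k) ^ 2 = -q ^ 2 ∨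
      (ipHypPt q w₀ ζ₀ i k) ^ 2 = -q := by
    intro k hk
    by_cases hki : k = i
    · subst hki; rw [ipHypPt_self, hζ]; exact Or.inr (Or.inl rfl)
    by_cases hki' : k = i + 1
    · subst hki'; rw [ipHypPt_succ, mul_pow, hζ]; right; right; linear_combination (-q) * hq3
    · rw [ipHypPt_of_ne q w₀ ζ₀ hk hki hki']; exact Or.inl (one_pow 2)
  have hval : ∀ k, k ≠ 0 → (-1 : ℂ) - (ipHypPt q w₀ ζ₀ i k) ^ 2 ≠ 0 := by
    intro k hk h
    rcases hsq k hk with h' | h' | h' <;> rw [h'] at h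
    · norm_num at h
    · apply hq1
      have : q ^ 2 = 1 := by linear_combination h
      have h3 : q = -2 := by linear_combination hq - this
      rw [h3] at this; norm_num at this
    · exact hq1 (by linear_combination h)
  refine ⟨by rwa [eval_C], by rwa [eval_X, h0], fun k hk => ?_, fun e he => ?_, fun e he => ?_⟩
  · rw [eval_X]
    intro h
    rcases hsq k hk with h' | h' | h' <;> rw [h] at h' <;> norm_num at h'
    all_goals exact hq0 h'
  · have hk := level_ne_zero_of_mem (Or.inl rfl) he
    have h := hval _ hk
    simp only [ipDenPoly, if_true, map_sub, map_mul, map_pow, eval_C, eval_X, h0, hw]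
    intro h'; apply h; linear_combination h' + hq3
  · have hk := level_ne_zero_of_mem (Or.inr rfl) he
    have h := hval _ hk
    simp only [ipDenPoly, show (1 : Fin 2) ≠ 0 from by decide, if_false, map_sub, map_mul, map_pow, map_one,
      eval_C, eval_X, h0, hw]
    intro h'; apply h; linear_combination h' + (ipHypPt q w₀ ζ₀ i (edgeTopLevel e).toNat) ^ 2 * hq3

/-- **LEMMA A (even `i = 2b`): the eigenvalue `1` of `t(w; z)` stays simple on the hyperplane
`z_{i+1} = q z_i`** — the adjugate of `t|_{H_i} - 1` is nonzero. [cite: IkhlefPonsaing2012, §3.4] -/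
theorem adjugate_ipTMatH_sub_one_ne_zero_even {q : ℂ} (hq : q ^ 2 + q + 1 = 0) (b : Fin (n + 2)) (hb : b ≠ 0) :
    adjugate (ipTMatH n q (2 * b) - 1) ≠ 0 := by
  have hq0 : q ≠ 0 := q_ne_zero_of_quad hq
  obtain ⟨w₀, hw⟩ := IsAlgClosed.exists_pow_nat_eq (-q) (n := 2) two_pos
  obtain ⟨ζ₀, hζ⟩ := IsAlgClosed.exists_pow_nat_eq (-q ^ 2) (n := 2) two_pos
  have hbv : (b : ℕ) ≠ 0 := fun h => hb (Fin.ext h)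
  have hi : 2 * (b : ℕ) ≠ 0 := by omega
  obtain ⟨hz, hden0, hden1⟩ := hypSubst_nondeg (K₀ := ℂ) hq0 hi (n + 1)
  obtain ⟨hC, hX0⟩ := comp_hypSubst_C_X0 (K₀ := ℂ) q (2 * (b : ℕ))
  obtain ⟨hq₀, hw₀, hz₀, hden0₀, hden1₀⟩ := hypPt_eval_nondeg hq hw hζ hi (n + 1)
  have hgC : (toRF ℂ).comp (hypSubst q (2 * b)) (C q) ≠ 0 := by rw [hC]; exact toRF_ne_zero_of_eval (fun _ => 1) (by simp [hq0])
  have hgX : (toRF ℂ).comp (hypSubst q (2 * b)) (X 0) ≠ 0 := by rw [hX0]; exact genW_ne_zero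
  have key := adjugate_sub_one_ne_zero_of_specialisation (m := n + 1) (hypSubst q (2 * b))
    (eval (ipHypPt q w₀ ζ₀ (2 * b))) (eval_comp_hypSubst (ipHypPt_hyp q w₀ ζ₀ _)) hgC hgX hz hden0 hden1
    hq₀ hw₀ hz₀ hden0₀ hden1₀ ?_
  · rw [hC, hX0] at key
    exact key
  · have h0 : ipHypPt q w₀ ζ₀ (2 * b) 0 = w₀ := by simp [ipHypPt, hi.symm]
    simp only [eval_C, eval_X, h0]
    exact adjugate_ne_zero_of_vecMul_line _ _ (ipTMatPt_vecMul_line_even hq hw hζ b hb)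
      ((fun _ _ => false), fun _ => false)

/-- **LEMMA A (odd `i = 2j+1`).** [cite: IkhlefPonsaing2012, §3.4] -/
theorem adjugate_ipTMatH_sub_one_ne_zero_odd {q : ℂ} (hq : q ^ 2 + q + 1 = 0) (j : Fin (n + 1)) :
    adjugate (ipTMatH n q (2 * j + 1) - 1) ≠ 0 := by
  have hq0 : q ≠ 0 := q_ne_zero_of_quad hq
  obtain ⟨w₀, hw⟩ := IsAlgClosed.exists_pow_nat_eq (-q) (n := 2) two_pos
  obtain ⟨ζ₀, hζ⟩ := IsAlgClosed.exists_pow_nat_eq (-q ^ 2) (n := 2) two_pos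
  have hi : 2 * (j : ℕ) + 1 ≠ 0 := by omega
  obtain ⟨hz, hden0, hden1⟩ := hypSubst_nondeg (K₀ := ℂ) hq0 hi (n + 1)
  obtain ⟨hC, hX0⟩ := comp_hypSubst_C_X0 (K₀ := ℂ) q (2 * (j : ℕ) + 1)
  obtain ⟨hq₀, hw₀, hz₀, hden0₀, hden1₀⟩ := hypPt_eval_nondeg hq hw hζ hi (n + 1)
  have hgC : (toRF ℂ).comp (hypSubst q (2 * j + 1)) (C q) ≠ 0 := by rw [hC]; exact toRF_ne_zero_of_eval (fun _ => 1) (by simp [hq0])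
  have hgX : (toRF ℂ).comp (hypSubst q (2 * j + 1)) (X 0) ≠ 0 := by rw [hX0]; exact genW_ne_zero
  have key := adjugate_sub_one_ne_zero_of_specialisation (m := n + 1) (hypSubst q (2 * j + 1))
    (eval (ipHypPt q w₀ ζ₀ (2 * j + 1))) (eval_comp_hypSubst (ipHypPt_hyp q w₀ ζ₀ _)) hgC hgX hz hden0 hden1
    hq₀ hw₀ hz₀ hden0₀ hden1₀ ?_
  · rw [hC, hX0] at key
    exact key
  · have h0 : ipHypPt q w₀ ζ₀ (2 * j + 1) 0 = w₀ := by simp [ipHypPt]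
    simp only [eval_C, eval_X, h0]
    exact adjugate_ne_zero_of_vecMul_line _ _ (ipTMatPt_vecMul_line_odd hq hw hζ j)
      ((fun _ _ => false), fun _ => false)

/-- **Corollary: on `H_i` any two `t`-fixed vectors are proportional** (`1 ≤ i ≤ 2n+2`, i.e. every
bulk position of the width-`2(n+1)+1` strip). [cite: IkhlefPonsaing2012, §3.4] -/
theorem ipTransferMatrixW_hyp_fixed_proportional {q : ℂ} (hq : q ^ 2 + q + 1 = 0) {i : ℕ} (hi : 1 ≤ i)
    (hi' : i ≤ 2 * n + 2) {ψ ψ' : ColPattern (n + 1) → RapidityField ℂ}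
    (hψ : ∀ Q', ∑ Q, ipTransferMatrixW (n + 1) (genC ℂ q) (genW ℂ) (genZH ℂ q i) Q Q' * ψ Q = ψ Q')
    (hψ' : ∀ Q', ∑ Q, ipTransferMatrixW (n + 1) (genC ℂ q) (genW ℂ) (genZH ℂ q i) Q Q' * ψ' Q = ψ' Q')
    (k : ColPattern (n + 1)) : ψ' k • ψ = ψ k • ψ' := by
  have hadj : adjugate (ipTMatH n q i - 1) ≠ 0 := by
    rcases Nat.even_or_odd i with ⟨b, hb⟩ | ⟨j, hj⟩
    · have hb' : b < n + 2 := by omega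
      have := adjugate_ipTMatH_sub_one_ne_zero_even (n := n) hq ⟨b, hb'⟩ (by
        intro h; have := congrArg Fin.val h; simp at this; omega)
      rwa [show i = 2 * ((⟨b, hb'⟩ : Fin (n + 2)) : ℕ) by simp; omega]
    · have hj' : j < n + 1 := by omega
      have := adjugate_ipTMatH_sub_one_ne_zero_odd (n := n) hq ⟨j, hj'⟩
      rwa [show i = 2 * ((⟨j, hj'⟩ : Fin (n + 1)) : ℕ) + 1 by simp; omega]
  have hker : ∀ φ : ColPattern (n + 1) → RapidityField ℂ,
      (∀ Q', ∑ Q, ipTransferMatrixW (n + 1) (genC ℂ q) (genW ℂ) (genZH ℂ q i) Q Q' * φ Q = φ Q') →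
        φ ᵥ* (ipTMatH n q i - 1) = 0 := by
    intro φ hφ
    rw [vecMul_sub_one_eq_zero_iff]
    intro Q'
    rw [← hφ Q']
    exact Finset.sum_congr rfl fun Q _ => mul_comm _ _
  exact vecMul_proportional_of_adjugate_ne_zero _ hadj (hker ψ hψ) (hker ψ' hψ') k

end LemmaA

/-! ### Restricting a polynomial ground state along a substitution -/

section Restriction

open MvPolynomial _root_.Matrix

variable {K₀ : Type*} [Field K₀] {m : ℕ}

/-- **A polynomial `t`-fixed vector stays fixed after any admissible substitution of the
rapidities** (`g` fixing `q` and `w`; the substituted transfer matrix has rapidities `g(X_k)`).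
[folklore] -/
theorem fixed_of_hom (g : MvPolynomial ℕ K₀ →+* MvPolynomial ℕ K₀) {q : K₀} (hq0 : q ≠ 0)
    (hgC : (toRF K₀).comp g (C q) = genC K₀ q) (hgX : (toRF K₀).comp g (X 0) = genW K₀)
    (hz : ∀ k, k ≠ 0 → (toRF K₀).comp g (X k) ≠ 0)
    (hden0 : ∀ e ∈ latticeLayer m 0, (toRF K₀).comp g (ipDenPoly q 0 e) ≠ 0)
    (hden1 : ∀ e ∈ latticeLayer m 1, (toRF K₀).comp g (ipDenPoly q 1 e) ≠ 0)
    {P : ColPattern m → MvPolynomial ℕ K₀}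
    (hP : ∀ Q', ∑ Q, ipTransferMatrixW m (genC K₀ q) (genW K₀) (genZ K₀) Q Q' * toRF K₀ (P Q) = toRF K₀ (P Q')) :
    ∀ Q', ∑ Q, ipTransferMatrixW m (genC K₀ q) (genW K₀) (fun k => (toRF K₀).comp g (X k)) Q Q' *
      toRF K₀ (g (P Q)) = toRF K₀ (g (P Q')) := by
  set F := (toRF K₀).comp g with hF
  have hFC : F (C q) ≠ 0 := by rw [hgC]; exact toRF_ne_zero_of_eval (fun _ => 1) (by simp [hq0])
  have hFX : F (X 0) ≠ 0 := by rw [hgX]; exact genW_ne_zero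
  -- the polynomial identity `P ᵥ* N = 0`
  have h1 : (fun Q => toRF K₀ (P Q)) ᵥ* (ipTMat m q - 1) = 0 := by
    rw [vecMul_sub_one_eq_zero_iff]
    intro Q'
    rw [← hP Q']
    exact Finset.sum_congr rfl fun Q _ => by rw [ipTMat_apply, mul_comm]
  have h2 : (fun Q => toRF K₀ (P Q)) ᵥ* (toRF K₀).mapMatrix (ipNMat m q) = 0 := by
    rw [mapMatrix_toRF_ipNMat hq0, Matrix.vecMul_smul, h1, smul_zero]
  have h3 : P ᵥ* ipNMat m q = 0 := by
    funext Q'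
    apply toRF_injective
    rw [RingHom.map_vecMul, Pi.zero_apply, map_zero]
    exact congrFun h2 Q'
  -- substitute and pass to the rapidity field
  have h4 : (fun Q => F (P Q)) ᵥ* F.mapMatrix (ipNMat m q) = 0 := by
    funext Q'
    have := RingHom.map_vecMul F (ipNMat m q) P Q'
    rw [h3, Pi.zero_apply, map_zero] at this
    rw [Pi.zero_apply, RingHom.mapMatrix_apply]
    exact this.symm
  rw [mapMatrix_hom_ipNMat F hFC hFX hz hden0 hden1, Matrix.vecMul_smul, smul_eq_zero] at h4
  rcases h4 with h4 | h4
  · exact absurd h4 (hom_ipDeltaPoly_ne_zero F hden0 hden1)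
  · rw [vecMul_sub_one_eq_zero_iff] at h4
    intro Q'
    have := h4 Q'
    simp only [Matrix.of_apply] at this
    rw [hgC, hgX] at this
    simp only [hF, RingHom.comp_apply] at this ⊢
    rw [← this]
    exact Finset.sum_congr rfl fun Q _ => mul_comm _ _

end Restriction

/-! ### The push-forward of the small ground state along `φ_i` is fixed on the hyperplane -/

section PushForward

open MvPolynomial _root_.Matrix

variable {K₀ : Type*} [Field K₀]

/-- `[A/B] ≠ 0` in the rapidity field when `A² ≠ B²` somewhere. [folklore] -/
theorem qbr_div_toRF_ne_zero {A B : MvPolynomial ℕ K₀} (hA : toRF K₀ A ≠ 0) (hB : toRF K₀ B ≠ 0)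
    (x : ℕ → K₀) (hne : eval x A ^ 2 ≠ eval x B ^ 2) : qbr (toRF K₀ A / toRF K₀ B) ≠ 0 := by
  refine qbr_ne_zero_of_sq_ne_one (div_ne_zero hA hB) ?_
  rw [div_pow, Ne, div_eq_one_iff_eq (pow_ne_zero _ hB), ← map_pow, ← map_pow]
  exact toRF_ne_of_eval x (by rwa [map_pow, map_pow])

variable {n : ℕ}

/-- The five non-degeneracy conditions of Lemma 3.3 at the generic point of `H_i`, even `i`.
[folklore] -/
theorem genZH_nondeg_even {q : K₀} (hq : q ≠ 0) (b : ℕ) (hb : b ≠ 0) :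
    let z := genZH K₀ q (2 * b)
    let w := genW K₀
    let c := genC K₀ q
    qbr (z (2 * b) / w) ≠ 0 ∧ qbr (c / (z (2 * b) / w)) ≠ 0 ∧ qbr (w * z (2 * b + 1))⁻¹ ≠ 0 ∧
      qbr (c / (w * z (2 * b + 1))⁻¹) ≠ 0 ∧ qbr (c / (c * (w * z (2 * b + 1))⁻¹)) ≠ 0 := by
  intro z w c
  have hi : 2 * b ≠ 0 := by omega
  have hz0 : z (2 * b) = toRF K₀ (X (2 * b)) := by
    show genZH K₀ q (2 * b) (2 * b) = _; rw [genZH_apply, if_neg (by omega)]; rfl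
  have hz1 : z (2 * b + 1) = toRF K₀ (C q * X (2 * b)) := by
    show genZH K₀ q (2 * b) (2 * b + 1) = _; rw [genZH_apply, if_pos rfl, map_mul]; rfl
  have hw : w = toRF K₀ (X 0) := rfl
  have hc : c = toRF K₀ (C q) := rfl
  have hc0 : c ≠ 0 := toRF_ne_zero_of_eval (fun _ => 1) (by simp [hq])
  have hX : ∀ k, toRF K₀ (X k) ≠ 0 := fun k => genZ_ne_zero k
  have hCq : toRF K₀ (C q) ≠ 0 := hc0
  -- test point: `X 0 ↦ 1`, everything else `↦ 0`
  set x : ℕ → K₀ := fun k => if k = 0 then 1 else 0 with hx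
  have hx0 : x 0 = 1 := by simp [hx]
  have hxb : x (2 * b) = 0 := by simp [hx, hi]
  refine ⟨?_, ?_, ?_, ?_, ?_⟩
  · rw [hz0, hw]
    exact qbr_div_toRF_ne_zero (hX _) (hX 0) x (by simp [hx0, hxb])
  · rw [hz0, hw, hc, div_div_eq_mul_div, ← map_mul]
    exact qbr_div_toRF_ne_zero (by rw [map_mul]; exact mul_ne_zero hCq (hX 0)) (hX _) x (by simp [hx0, hxb, hq])
  · rw [hz1, hw, ← map_mul, inv_eq_one_div, ← (toRF K₀).map_one]
    refine qbr_div_toRF_ne_zero (by rw [map_one]; exact one_ne_zero) ?_ x (by simp [hx0, hxb])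
    rw [map_mul, map_mul]; exact mul_ne_zero (hX 0) (mul_ne_zero hCq (hX _))
  · rw [hz1, hw, hc, div_inv_eq_mul, ← map_mul, ← map_mul, ← div_one (toRF K₀ _), ← (toRF K₀).map_one]
    refine qbr_div_toRF_ne_zero ?_ (by rw [map_one]; exact one_ne_zero) x (by simp [hx0, hxb])
    rw [map_mul, map_mul, map_mul]; exact mul_ne_zero hCq (mul_ne_zero (hX 0) (mul_ne_zero hCq (hX _)))
  · rw [div_mul_eq_div_div, div_self hc0, one_div, inv_inv, hz1, hw, ← map_mul, ← div_one (toRF K₀ _),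
      ← (toRF K₀).map_one]
    refine qbr_div_toRF_ne_zero ?_ (by rw [map_one]; exact one_ne_zero) x (by simp [hx0, hxb])
    rw [map_mul, map_mul]; exact mul_ne_zero (hX 0) (mul_ne_zero hCq (hX _))

/-- The five non-degeneracy conditions of Lemma 3.3 at the generic point of `H_i`, odd `i`.
[folklore] -/
theorem genZH_nondeg_odd {q : K₀} (hq : q ≠ 0) (j : ℕ) :
    let z := genZH K₀ q (2 * j + 1)
    let w := genW K₀
    let c := genC K₀ q
    qbr (z (2 * j + 1) / w) ≠ 0 ∧ qbr (c / (z (2 * j + 1) / w)) ≠ 0 ∧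
      qbr (c / (c * (z (2 * j + 1) / w))) ≠ 0 ∧ qbr (w * z (2 * j + 1 + 1))⁻¹ ≠ 0 ∧
      qbr (c / (w * z (2 * j + 1 + 1))⁻¹) ≠ 0 := by
  intro z w c
  have hi : 2 * j + 1 ≠ 0 := by omega
  have hz0 : z (2 * j + 1) = toRF K₀ (X (2 * j + 1)) := by
    show genZH K₀ q (2 * j + 1) (2 * j + 1) = _; rw [genZH_apply, if_neg (by omega)]; rfl
  have hz1 : z (2 * j + 1 + 1) = toRF K₀ (C q * X (2 * j + 1)) := by
    show genZH K₀ q (2 * j + 1) (2 * j + 1 + 1) = _; rw [genZH_apply, if_pos rfl, map_mul]; rfl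
  have hw : w = toRF K₀ (X 0) := rfl
  have hc : c = toRF K₀ (C q) := rfl
  have hc0 : c ≠ 0 := toRF_ne_zero_of_eval (fun _ => 1) (by simp [hq])
  have hX : ∀ k, toRF K₀ (X k) ≠ 0 := fun k => genZ_ne_zero k
  have hCq : toRF K₀ (C q) ≠ 0 := hc0
  set x : ℕ → K₀ := fun k => if k = 0 then 1 else 0 with hx
  have hx0 : x 0 = 1 := by simp [hx]
  have hxb : x (2 * j + 1) = 0 := by simp [hx]
  refine ⟨?_, ?_, ?_, ?_, ?_⟩
  · rw [hz0, hw]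
    exact qbr_div_toRF_ne_zero (hX _) (hX 0) x (by simp [hx0, hxb])
  · rw [hz0, hw, hc, div_div_eq_mul_div, ← map_mul]
    exact qbr_div_toRF_ne_zero (by rw [map_mul]; exact mul_ne_zero hCq (hX 0)) (hX _) x (by simp [hx0, hxb, hq])
  · rw [div_mul_eq_div_div, div_self hc0, one_div, inv_div, hz0, hw]
    exact qbr_div_toRF_ne_zero (hX 0) (hX _) x (by simp [hx0, hxb])
  · rw [hz1, hw, ← map_mul, inv_eq_one_div, ← (toRF K₀).map_one]
    refine qbr_div_toRF_ne_zero (by rw [map_one]; exact one_ne_zero) ?_ x (by simp [hx0, hxb])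
    rw [map_mul, map_mul]; exact mul_ne_zero (hX 0) (mul_ne_zero hCq (hX _))
  · rw [hz1, hw, hc, div_inv_eq_mul, ← map_mul, ← map_mul, ← div_one (toRF K₀ _), ← (toRF K₀).map_one]
    refine qbr_div_toRF_ne_zero ?_ (by rw [map_one]; exact one_ne_zero) x (by simp [hx0, hxb])
    rw [map_mul, map_mul, map_mul]; exact mul_ne_zero hCq (mul_ne_zero (hX 0) (mul_ne_zero hCq (hX _)))

/-- A fibrewise sum against the kernel. [folklore] -/
theorem sum_fiber_mul' {K : Type*} [Field K] {γ δ : Type*} [Fintype γ] [Fintype δ] [DecidableEq δ]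
    (g : γ → δ) (f : γ → K) (h : δ → K) :
    ∑ y, h y * (∑ x ∈ Finset.univ.filter (fun x => g x = y), f x) = ∑ x, h (g x) * f x := by
  rw [show (∑ y, h y * ∑ x ∈ Finset.univ.filter (fun x => g x = y), f x) =
      ∑ y, (∑ x ∈ Finset.univ.filter (fun x => g x = y), f x) * h y from
    Finset.sum_congr rfl fun _ _ => mul_comm _ _, sum_fiber_mul]
  exact Finset.sum_congr rfl fun _ _ => mul_comm _ _

/-- **The push-forward of a `t_{L-2}(ẑ)`-fixed vector along `φ_i = cpInsIso b` is `t_L|_{H_i}`-fixed**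
(even `i = 2b`; Lemma 3.3 at the generic point of the hyperplane). [cite: IkhlefPonsaing2012, eq. (25)] -/
theorem fixed_pushforward_cpInsIso {q : K₀} (hq : q ^ 2 + q + 1 = 0) (b : Fin (n + 2)) (hb : b ≠ 0)
    {ψ' : ColPattern n → RapidityField K₀}
    (hψ' : ∀ Q', ∑ P, ipTransferMatrixW n (genC K₀ q) (genW K₀) (zHat (genZH K₀ q (2 * b)) (2 * b)) P Q' * ψ' P = ψ' Q') :
    ∀ Q'', ∑ Q, ipTransferMatrixW (n + 1) (genC K₀ q) (genW K₀) (genZH K₀ q (2 * b)) Q Q'' *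
      (∑ P ∈ Finset.univ.filter (fun P => cpInsIso b P = Q), ψ' P) =
        ∑ P ∈ Finset.univ.filter (fun P => cpInsIso b P = Q''), ψ' P := by
  classical
  have hq0 : q ≠ 0 := q_ne_zero_of_quad hq
  have hbv : (b : ℕ) ≠ 0 := fun h => hb (Fin.ext h)
  obtain ⟨n1, n2, n3, n4, n5⟩ := genZH_nondeg_even (K₀ := K₀) hq0 (b : ℕ) hbv
  intro Q''
  rw [sum_fiber_mul' (cpInsIso b) ψ' (fun Q => ipTransferMatrixW (n + 1) _ _ _ Q Q'')]
  simp_rw [ipTransferMatrixW_cpInsIso (genC_quad hq) (genW K₀) (genZH K₀ q (2 * b)) b hb (genZH_hyp q _)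
    n1 n2 n3 n4 n5 _ Q'', Finset.sum_mul]
  rw [Finset.sum_comm]
  refine Finset.sum_congr rfl fun Q' _ => ?_
  rw [← hψ' Q']

/-- **The push-forward along `φ_i = cpInsDup j` is `t_L|_{H_i}`-fixed** (odd `i = 2j+1`).
[cite: IkhlefPonsaing2012, eq. (25)] -/
theorem fixed_pushforward_cpInsDup {q : K₀} (hq : q ^ 2 + q + 1 = 0) (j : Fin (n + 1))
    {ψ' : ColPattern n → RapidityField K₀}
    (hψ' : ∀ Q', ∑ P, ipTransferMatrixW n (genC K₀ q) (genW K₀) (zHat (genZH K₀ q (2 * j + 1)) (2 * j + 1)) P Q' *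
      ψ' P = ψ' Q') :
    ∀ Q'', ∑ Q, ipTransferMatrixW (n + 1) (genC K₀ q) (genW K₀) (genZH K₀ q (2 * j + 1)) Q Q'' *
      (∑ P ∈ Finset.univ.filter (fun P => cpInsDup j P = Q), ψ' P) =
        ∑ P ∈ Finset.univ.filter (fun P => cpInsDup j P = Q''), ψ' P := by
  classical
  have hq0 : q ≠ 0 := q_ne_zero_of_quad hq
  obtain ⟨n1, n2, n3, n4, n5⟩ := genZH_nondeg_odd (K₀ := K₀) hq0 (j : ℕ)
  -- `ψ'` vanishes at non-reflexive patterns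
  have hsupp : ∀ P, (∃ x, P.1 x x = false) → ψ' P = 0 := by
    rintro P ⟨x, hx⟩
    rw [← hψ' P]
    exact Finset.sum_eq_zero fun P₀ _ => by rw [ipTransferMatrixW_eq_zero_of_not_refl _ _ _ P₀ P hx, zero_mul]
  intro Q''
  rw [sum_fiber_mul' (cpInsDup j) ψ' (fun Q => ipTransferMatrixW (n + 1) _ _ _ Q Q'')]
  have key : ∀ P, ipTransferMatrixW (n + 1) (genC K₀ q) (genW K₀) (genZH K₀ q (2 * j + 1)) (cpInsDup j P) Q'' * ψ' P =
      (∑ Q' ∈ Finset.univ.filter (fun Q' => cpInsDup j Q' = Q''),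
        ipTransferMatrixW n (genC K₀ q) (genW K₀) (zHat (genZH K₀ q (2 * j + 1)) (2 * j + 1)) P Q') * ψ' P := by
    intro P
    by_cases hP : ∀ x, P.1 x x = true
    · rw [ipTransferMatrixW_cpInsDup (genC_quad hq) (genW K₀) (genZH K₀ q (2 * j + 1)) j (genZH_hyp q _)
        n1 n2 n3 n4 n5 (hP j) Q'']
    · obtain ⟨x, hx⟩ := not_forall.1 hP
      rw [hsupp P ⟨x, Bool.eq_false_iff.2 hx⟩, mul_zero, mul_zero]
  simp_rw [key, Finset.sum_mul]
  rw [Finset.sum_comm]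
  refine Finset.sum_congr rfl fun Q' _ => ?_
  rw [← hψ' Q']

end PushForward

/-! ### The recursion of the generic ground state on the hyperplanes, up to a scalar -/

section Recursion

open MvPolynomial _root_.Matrix

variable {n : ℕ}

/-- **The small generic ground state in the variables `ẑ` is fixed by `t_{L-2}(w; ẑ)`.**
[cite: IkhlefPonsaing2012, eq. (25)] -/
theorem toRF_hatRename_fixed {q : ℂ} (hq : q ^ 2 + q + 1 = 0) {i : ℕ} (hi : i ≠ 0)
    {P' : ColPattern n → MvPolynomial ℕ ℂ}
    (hP' : ∀ Q', ∑ Q, ipTransferMatrixW n (genC ℂ q) (genW ℂ) (genZ ℂ) Q Q' * toRF ℂ (P' Q) = toRF ℂ (P' Q')) :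
    ∀ Q', ∑ Q, ipTransferMatrixW n (genC ℂ q) (genW ℂ) (zHat (genZH ℂ q i) i) Q Q' * toRF ℂ (hatRename i (P' Q)) =
      toRF ℂ (hatRename i (P' Q')) := by
  have hq0 : q ≠ 0 := q_ne_zero_of_quad hq
  obtain ⟨hz, hden0, hden1⟩ := hatRename_nondeg (K₀ := ℂ) hq0 i n
  rw [zHat_genZH]
  exact fixed_of_hom (hatRename i) hq0 (comp_hatRename_C_X0 q hi).1 (comp_hatRename_C_X0 q hi).2 hz hden0 hden1 hP'

/-- **The generic ground state restricted to `H_i` is fixed by `t_L(w; z)|_{H_i}`.**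
[cite: IkhlefPonsaing2012, eq. (25)] -/
theorem toRF_hypSubst_fixed {q : ℂ} (hq : q ^ 2 + q + 1 = 0) {i : ℕ} (hi : i ≠ 0)
    {P : ColPattern (n + 1) → MvPolynomial ℕ ℂ}
    (hP : ∀ Q', ∑ Q, ipTransferMatrixW (n + 1) (genC ℂ q) (genW ℂ) (genZ ℂ) Q Q' * toRF ℂ (P Q) = toRF ℂ (P Q')) :
    ∀ Q', ∑ Q, ipTransferMatrixW (n + 1) (genC ℂ q) (genW ℂ) (genZH ℂ q i) Q Q' * toRF ℂ (hypSubst q i (P Q)) =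
      toRF ℂ (hypSubst q i (P Q')) := by
  have hq0 : q ≠ 0 := q_ne_zero_of_quad hq
  obtain ⟨hz, hden0, hden1⟩ := hypSubst_nondeg (K₀ := ℂ) hq0 hi (n + 1)
  exact fixed_of_hom (hypSubst q i) hq0 (comp_hypSubst_C_X0 q i).1 (comp_hypSubst_C_X0 q i).2 hz hden0 hden1 hP

/-- **IP12 eq. (25) up to the scalar, even `i = 2b`: on the hyperplane `z_{i+1} = q z_i` the generic
ground state `Ψ_L` is proportional (over the function field of the hyperplane) to
`φ_i Ψ_{L-2}(ẑ)`** — here `Ψ_L`, `Ψ_{L-2}` are ANY polynomial `t`-fixed vectors of the two sizes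
(`exists_ipTransferMatrixW_fixed_polynomial`), `Ψ_L|_{H_i} = hypSubst ∘ Ψ_L`,
`Ψ_{L-2}(ẑ) = hatRename ∘ Ψ_{L-2}`, and `φ_i` = push-forward along `cpInsIso b`.
[cite: IkhlefPonsaing2012, eq. (25)] -/
theorem groundState_hyp_recursion_even {q : ℂ} (hq : q ^ 2 + q + 1 = 0) (b : Fin (n + 2)) (hb : b ≠ 0)
    {P : ColPattern (n + 1) → MvPolynomial ℕ ℂ}
    (hP : ∀ Q', ∑ Q, ipTransferMatrixW (n + 1) (genC ℂ q) (genW ℂ) (genZ ℂ) Q Q' * toRF ℂ (P Q) = toRF ℂ (P Q'))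
    {P' : ColPattern n → MvPolynomial ℕ ℂ}
    (hP' : ∀ Q', ∑ Q, ipTransferMatrixW n (genC ℂ q) (genW ℂ) (genZ ℂ) Q Q' * toRF ℂ (P' Q) = toRF ℂ (P' Q'))
    (k : ColPattern (n + 1)) :
    (∑ R ∈ Finset.univ.filter (fun R => cpInsIso b R = k), toRF ℂ (hatRename (2 * b) (P' R))) •
        (fun Q => toRF ℂ (hypSubst q (2 * b) (P Q))) =
      toRF ℂ (hypSubst q (2 * b) (P k)) •
        (fun Q => ∑ R ∈ Finset.univ.filter (fun R => cpInsIso b R = Q), toRF ℂ (hatRename (2 * b) (P' R))) := by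
  have hbv : (b : ℕ) ≠ 0 := fun h => hb (Fin.ext h)
  have hb2 := b.2
  have hi : 2 * (b : ℕ) ≠ 0 := by omega
  exact ipTransferMatrixW_hyp_fixed_proportional hq (i := 2 * b) (by omega) (by omega)
    (toRF_hypSubst_fixed hq hi hP)
    (fixed_pushforward_cpInsIso hq b hb (toRF_hatRename_fixed hq hi hP')) k

/-- **IP12 eq. (25) up to the scalar, odd `i = 2j+1`** (push-forward along `cpInsDup j`).
[cite: IkhlefPonsaing2012, eq. (25)] -/
theorem groundState_hyp_recursion_odd {q : ℂ} (hq : q ^ 2 + q + 1 = 0) (j : Fin (n + 1))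
    {P : ColPattern (n + 1) → MvPolynomial ℕ ℂ}
    (hP : ∀ Q', ∑ Q, ipTransferMatrixW (n + 1) (genC ℂ q) (genW ℂ) (genZ ℂ) Q Q' * toRF ℂ (P Q) = toRF ℂ (P Q'))
    {P' : ColPattern n → MvPolynomial ℕ ℂ}
    (hP' : ∀ Q', ∑ Q, ipTransferMatrixW n (genC ℂ q) (genW ℂ) (genZ ℂ) Q Q' * toRF ℂ (P' Q) = toRF ℂ (P' Q'))
    (k : ColPattern (n + 1)) :
    (∑ R ∈ Finset.univ.filter (fun R => cpInsDup j R = k), toRF ℂ (hatRename (2 * j + 1) (P' R))) •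
        (fun Q => toRF ℂ (hypSubst q (2 * j + 1) (P Q))) =
      toRF ℂ (hypSubst q (2 * j + 1) (P k)) •
        (fun Q => ∑ R ∈ Finset.univ.filter (fun R => cpInsDup j R = Q), toRF ℂ (hatRename (2 * j + 1) (P' R))) := by
  have hj2 := j.2
  have hi : 2 * (j : ℕ) + 1 ≠ 0 := by omega
  exact ipTransferMatrixW_hyp_fixed_proportional hq (i := 2 * j + 1) (by omega) (by omega)
    (toRF_hypSubst_fixed hq hi hP)
    (fixed_pushforward_cpInsDup hq j (toRF_hatRename_fixed hq hi hP')) k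

/-- A `t`-fixed vector vanishes at non-reflexive patterns. [folklore] -/
theorem fixed_eq_zero_of_not_refl {K : Type*} [Field K] {m : ℕ} {q w : K} {z : ℕ → K} {ψ : ColPattern m → K}
    (hψ : ∀ Q', ∑ Q, ipTransferMatrixW m q w z Q Q' * ψ Q = ψ Q') {Q : ColPattern m} (hQ : ∃ x, Q.1 x x = false) :
    ψ Q = 0 := by
  obtain ⟨x, hx⟩ := hQ
  rw [← hψ Q]
  exact Finset.sum_eq_zero fun Q₀ _ => by rw [ipTransferMatrixW_eq_zero_of_not_refl _ _ _ Q₀ Q hx, zero_mul]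

/-- **The push-forward of a nonzero small ground state is nonzero** (even `i`): so the scalar in
`groundState_hyp_recursion_even` is a genuine ratio. [folklore] -/
theorem pushforward_cpInsIso_ne_zero {q : ℂ} (hq : q ^ 2 + q + 1 = 0) (b : Fin (n + 2)) (hb : b ≠ 0)
    {P' : ColPattern n → MvPolynomial ℕ ℂ} (hP'0 : P' ≠ 0)
    (hP' : ∀ Q', ∑ Q, ipTransferMatrixW n (genC ℂ q) (genW ℂ) (genZ ℂ) Q Q' * toRF ℂ (P' Q) = toRF ℂ (P' Q')) :
    (fun Q => ∑ R ∈ Finset.univ.filter (fun R => cpInsIso b R = Q), toRF ℂ (hatRename (2 * b) (P' R))) ≠ 0 := by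
  classical
  have hbv : (b : ℕ) ≠ 0 := fun h => hb (Fin.ext h)
  have hi : 2 * (b : ℕ) ≠ 0 := by omega
  obtain ⟨R₀, hR₀⟩ : ∃ R₀, P' R₀ ≠ 0 := by
    by_contra h
    exact hP'0 (funext fun R => not_not.1 fun hR => h ⟨R, hR⟩)
  have hfix := toRF_hatRename_fixed hq hi hP'
  have hval : toRF ℂ (hatRename (2 * b) (P' R₀)) ≠ 0 := fun h =>
    hR₀ (hatRename_injective _ (by rw [toRF_injective (h.trans (map_zero _).symm), map_zero]))
  have hrefl : ∀ x, R₀.1 x x = true := by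
    by_contra h
    obtain ⟨x, hx⟩ := not_forall.1 h
    exact hval (fixed_eq_zero_of_not_refl hfix ⟨x, Bool.eq_false_iff.2 hx⟩)
  intro h
  have h0 := congrFun h (cpInsIso b R₀)
  rw [Pi.zero_apply, Finset.sum_eq_single_of_mem R₀ (by simp)] at h0
  · exact hval h0
  · intro R hR hne
    have hR' : cpInsIso b R = cpInsIso b R₀ := (Finset.mem_filter.1 hR).2
    apply fixed_eq_zero_of_not_refl hfix
    by_contra hR2
    push Not at hR2
    have hreflR : ∀ x, R.1 x x = true := fun x => by
      have := hR2 x; cases h' : R.1 x x <;> simp_all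
    exact hne (cpInsIso_inj_of_refl hreflR hrefl hR')

/-- **The push-forward of a nonzero small ground state is nonzero** (odd `i`). [folklore] -/
theorem pushforward_cpInsDup_ne_zero {q : ℂ} (hq : q ^ 2 + q + 1 = 0) (j : Fin (n + 1))
    {P' : ColPattern n → MvPolynomial ℕ ℂ} (hP'0 : P' ≠ 0) :
    (fun Q => ∑ R ∈ Finset.univ.filter (fun R => cpInsDup j R = Q), toRF ℂ (hatRename (2 * j + 1) (P' R))) ≠ 0 := by
  classical
  have _hq0 := q_ne_zero_of_quad hq
  obtain ⟨R₀, hR₀⟩ : ∃ R₀, P' R₀ ≠ 0 := by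
    by_contra h
    exact hP'0 (funext fun R => not_not.1 fun hR => h ⟨R, hR⟩)
  have hval : toRF ℂ (hatRename (2 * j + 1) (P' R₀)) ≠ 0 := fun h =>
    hR₀ (hatRename_injective _ (by rw [toRF_injective (h.trans (map_zero _).symm), map_zero]))
  intro h
  have h0 := congrFun h (cpInsDup j R₀)
  rw [Pi.zero_apply, Finset.sum_eq_single_of_mem R₀ (by simp)] at h0
  · exact hval h0
  · intro R hR hne
    exact absurd (cpInsDup_injective j (Finset.mem_filter.1 hR).2) hne

end Recursion

end Literature.Probability.Percolation
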